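import Literature.Computability.AlgebraicComplexity.StrongUSP
import HarnessLib

/-!
# ω-census, family (b′) STPP / USP: the triangular criterion for USPs and a 7-row USP of width 4 in the kernel

HONEST FRAMING (pub-omega census; verbatim): lottery ticket; floor = certified bounds/negative ranges.
Census BOOKKEEPING — a kernel WITNESS for the lower half of the width-4 USP cell (`s_max^USP(4) ≥ 7`; the census value is
`s_max^USP(4) = 7`, `run/shared/lean/pub/pub-omega/pub-omega-stpp-1-g2/CENSUS-TABLE.md` §B, ×3 by engines, not in print).  Plain USPs
carry no bound on `ω`; nothing here touches `ω`.

Verifying the USP property of Cohn–Kleinberg–Szegedy–Umans 2005 (§3) for `s` rows means quantifying over all `(s!)²` pairs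
`(π₂, π₃)` (with `π₁ = 1`), out of reach of `decide` for `s = 7`.  A cheap SUFFICIENT condition: order the rows `u₀ < u₁ < … `; if for
every `u` and all `v, w ≥ u` with `(v, w) ≠ (u, u)` the triple `(u, v, w)` has a column with at least two of `u = 1, v = 2, w = 3`
(`TriLoud`), the puzzle is a USP (`isUSP_of_triLoud`): for `(σ, τ) ≠ (1, 1)` take the LEAST row `x` moved by `σ` or `τ`; all smaller
rows are fixed, so by injectivity `σ x, τ x ≥ x`, and the hypothesis supplies the column.  (Equivalently: the obvious depth-first search
for a violating pair dies at depth one in every branch.)  The 7-row puzzle `{1111, 3211, 1321, 2231, 3312, 2123, 3223}` — the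
lexicographically first of the 2 293 `S₃ × S₄`-classes of 7-row USPs of width 4 found by the census — satisfies it in its sorted order
(`7³ · 4` column tests by `decide`), so `isUSP_7_4`.
-/

namespace Summit.MatrixMultiplication.OmegaCensus

open Literature.Computability.AlgebraicComplexity Equiv

/-- The **triangular loudness** condition of an ordered puzzle: every triple `(u, v, w)` with `v, w ≥ u`, not the constant triple,
has a column with at least two of `u = 1`, `v = 2`, `w = 3`. [folklore] -/
def TriLoud {s k : ℕ} (row : Fin s → Fin k → Fin 3) : Prop :=
  ∀ u v w : Fin s, u ≤ v → u ≤ w → (v ≠ u ∨ w ≠ u) → ∃ i : Fin k, USPAtLeastTwo (row u i) (row v i) (row w i)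

/-- Decidability of `TriLoud` (plumbing for `decide`). [folklore] -/
instance TriLoud.instDecidable {s k : ℕ} (row : Fin s → Fin k → Fin 3) : Decidable (TriLoud row) := by
  unfold TriLoud; infer_instance

/-- **The triangular criterion**: a triangularly loud ordered puzzle is a USP.  For `π₁, π₂, π₃` not all equal put `σ = π₂π₁⁻¹`,
`τ = π₃π₁⁻¹ ≠ (1, 1)` and let `x` be the least row moved by `σ` or `τ`; rows below `x` are fixed by both, so `σ x, τ x ≥ x` by
injectivity, and `TriLoud` gives the column at `u = π₁⁻¹ x`. [cite: CohnKleinbergSzegedyUmans2005, §3 (p. 5), definition of a USP] -/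
theorem isUSP_of_triLoud {s k : ℕ} {row : Fin s → Fin k → Fin 3} (h : TriLoud row) : IsUSP row := by
  classical
  intro π₁ π₂ π₃
  by_cases heq : π₁ = π₂ ∧ π₂ = π₃
  · exact Or.inl heq
  right
  set σ : Perm (Fin s) := π₂ * π₁⁻¹ with hσ
  set τ : Perm (Fin s) := π₃ * π₁⁻¹ with hτ
  -- some row is moved by `σ` or `τ`
  have hmoved : (Finset.univ.filter fun x : Fin s => σ x ≠ x ∨ τ x ≠ x).Nonempty := by
    by_contra hnone
    rw [Finset.not_nonempty_iff_eq_empty, Finset.filter_eq_empty_iff] at hnone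
    apply heq
    have hboth : ∀ x : Fin s, σ x = x ∧ τ x = x := fun x => by
      have := hnone (Finset.mem_univ x)
      simp only [not_or, not_not] at this
      exact this
    have hs : σ = 1 := Equiv.ext fun x => (hboth x).1
    have ht : τ = 1 := Equiv.ext fun x => (hboth x).2
    rw [hσ, mul_inv_eq_one] at hs
    rw [hτ, mul_inv_eq_one] at ht
    exact ⟨hs.symm, hs.trans ht.symm⟩
  -- the least moved row
  set S := Finset.univ.filter fun x : Fin s => σ x ≠ x ∨ τ x ≠ x with hS
  set x := S.min' hmoved with hx
  have hxS : x ∈ S := Finset.min'_mem S hmoved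
  have hxmv : σ x ≠ x ∨ τ x ≠ x := (Finset.mem_filter.1 hxS).2
  have hfix : ∀ y : Fin s, y < x → σ y = y ∧ τ y = y := fun y hy => by
    by_contra hne
    have hyS : y ∈ S := Finset.mem_filter.2 ⟨Finset.mem_univ y, by tauto⟩
    exact absurd (Finset.min'_le S y hyS) (not_le.2 (hx ▸ hy))
  have hσx : x ≤ σ x := by
    by_contra hlt
    rw [not_le] at hlt
    have h1 : σ (σ x) = σ x := (hfix (σ x) hlt).1
    exact absurd (σ.injective h1) (ne_of_lt hlt)
  have hτx : x ≤ τ x := by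
    by_contra hlt
    rw [not_le] at hlt
    have h1 : τ (τ x) = τ x := (hfix (τ x) hlt).2
    exact absurd (τ.injective h1) (ne_of_lt hlt)
  obtain ⟨i, hi⟩ := h x (σ x) (τ x) hσx hτx hxmv
  refine ⟨π₁⁻¹ x, i, ?_⟩
  have e1 : π₁ (π₁⁻¹ x) = x := Equiv.apply_symm_apply π₁ x
  have e2 : π₂ (π₁⁻¹ x) = σ x := by rw [hσ, Perm.mul_apply]
  have e3 : π₃ (π₁⁻¹ x) = τ x := by rw [hτ, Perm.mul_apply]
  rw [e1, e2, e3]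
  exact hi

/-- **A USP of width 4 with seven rows**: `{1111, 3211, 1321, 2231, 3312, 2123, 3223}` (symbols `1,2,3` coded `0,1,2`; the
lexicographically first class representative of the census's 2 293 classes of 7-row USPs of width 4), triangularly loud in this
order.  With the census's "no USP of width 4 has 8 rows" (engines ×3; kernel version pending) this is `s_max^USP(4) = 7`; the kernel
part stated here is the lower bound. [cite: CohnKleinbergSzegedyUmans2005, §3 (p. 5), definition of a USP] -/
theorem isUSP_7_4 : IsUSP ![![0, 0, 0, 0], ![2, 1, 0, 0], ![0, 2, 1, 0], ![1, 1, 2, 0], ![2, 2, 0, 1], ![1, 0, 1, 2], ![2, 1, 1, 2]] :=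
  isUSP_of_triLoud (by decide)

/-- Hence USPs of width 4 with `s` rows exist for every `s ≤ 7` (subpuzzles). [cite: AndersonJiXu2020, Lemma 5 (arXiv:2301.00074v1 §3.5)] -/
theorem exists_isUSP_width_four {s : ℕ} (hs : s ≤ 7) : ∃ row : Fin s → Fin 4 → Fin 3, IsUSP row :=
  ⟨_, isUSP_7_4.restrict (Fin.castLE hs) (Fin.castLE_injective hs)⟩

/-- **A USP of width 5 with fourteen rows**: `{11111, 31121, 23111, 32131, 21123, 33112, 12312, 11233, 21332, 22313, 32123, 23231,
13322, 33232}`, triangularly loud in this order (`14³ · 5` column tests in the kernel).  Found by a look-ahead search for triangular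
sequences (`run/shared/lean/pub/pub-omega/pub-omega-stpp-1-g4/code/triusp3.py`); 14 is also the largest USP of width 5 the census's
randomized engine search produced (`…/pub-omega-stpp-1-g2/CENSUS-TABLE.md` §B: `s_max^USP(5) ≥ 14`, exact maximum not claimed; not in
print), against `s_max^SUSP(5) = 8` for STRONG USPs (AJX Table 1).  Kernel content: the lower bound `s_max^USP(5) ≥ 14`.
[cite: CohnKleinbergSzegedyUmans2005, §3 (p. 5), definition of a USP] -/
theorem isUSP_14_5 : IsUSP ![![0, 0, 0, 0, 0], ![2, 0, 0, 1, 0], ![1, 2, 0, 0, 0], ![2, 1, 0, 2, 0], ![1, 0, 0, 1, 2], ![2, 2, 0, 0, 1],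
    ![0, 1, 2, 0, 1], ![0, 0, 1, 2, 2], ![1, 0, 2, 2, 1], ![1, 1, 2, 0, 2], ![2, 1, 0, 1, 2], ![1, 2, 1, 2, 0], ![0, 2, 2, 1, 1],
    ![2, 2, 1, 2, 1]] :=
  isUSP_of_triLoud (by decide +kernel)

/-- Hence USPs of width 5 with `s` rows exist for every `s ≤ 14` — in particular beyond the maximum size `8` of STRONG USPs of width 5.
[cite: AndersonJiXu2020, Lemma 5 and Table 1 (arXiv:2301.00074v1)] -/
theorem exists_isUSP_width_five {s : ℕ} (hs : s ≤ 14) : ∃ row : Fin s → Fin 5 → Fin 3, IsUSP row :=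
  ⟨_, isUSP_14_5.restrict (Fin.castLE hs) (Fin.castLE_injective hs)⟩

/-- **A USP of width 6 with 21 rows**: `{111111, 123111, 131211, 122311, 121231, 133112, 112213, 111323, 211133, 312112, 331221, 321312, 311232, 232113, 213312, 323212, 332321, 213232, 123223, 322123, 222333}` (symbols `1,2,3` coded
`0,1,2`), triangularly loud in this order (`21³ · 6` column tests in the kernel; found by the look-ahead search
`run/shared/lean/pub/pub-omega/pub-omega-stpp-1-g4/code/triusp6.py`).  For comparison, the largest STRONG USP of width 6 known has 14 rows
(Anderson–Ji–Xu 2020 Table 1, conjectured maximum; the tree's `isStrongUSP_AndersonLe_14_6_cert`), so plain USPs of width 6 are strictly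
larger than every known strong one.  Census bookkeeping (a kernel lower bound `s_max^USP(6) ≥ 21`; not in print); plain USPs carry no `ω` bound.
[cite: CohnKleinbergSzegedyUmans2005, §3 (p. 5), definition of a USP] -/
theorem isUSP_21_6 :
    IsUSP ![![0, 0, 0, 0, 0, 0], ![0, 1, 2, 0, 0, 0], ![0, 2, 0, 1, 0, 0], ![0, 1, 1, 2, 0, 0], ![0, 1, 0, 1, 2, 0], ![0, 2, 2, 0, 0, 1], ![0, 0, 1, 1, 0, 2],
      ![0, 0, 0, 2, 1, 2], ![1, 0, 0, 0, 2, 2], ![2, 0, 1, 0, 0, 1], ![2, 2, 0, 1, 1, 0], ![2, 1, 0, 2, 0, 1], ![2, 0, 0, 1, 2, 1], ![1, 2, 1, 0, 0, 2],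
      ![1, 0, 2, 2, 0, 1], ![2, 1, 2, 1, 0, 1], ![2, 2, 1, 2, 1, 0], ![1, 0, 2, 1, 2, 1], ![0, 1, 2, 1, 1, 2], ![2, 1, 1, 0, 1, 2], ![1, 1, 1, 2, 2, 2]] :=
  isUSP_of_triLoud (by decide +kernel)

/-- Hence USPs of width 6 with `s` rows exist for every `s ≤ 21`. [cite: AndersonJiXu2020, Lemma 5 (arXiv:2301.00074v1 §3.5)] -/
theorem exists_isUSP_width_six {s : ℕ} (hs : s ≤ 21) : ∃ row : Fin s → Fin 6 → Fin 3, IsUSP row :=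
  ⟨_, isUSP_21_6.restrict (Fin.castLE hs) (Fin.castLE_injective hs)⟩

/-- **A USP of width 7 with 28 rows**: `{3111111, 1113112, 1311211, 2311311, 3211113, 2131112, 3311121, 1121313, 3123211, 1213312, 3312113, 2232113, 1212132, 1323312, 3122313, 2331211, 1223131, 2332213, 3211233, 2221331, 2133321, 1232231, 3231232, 3333221, 3122332, 2313223, 1323323, 2232233}`
(symbols `1,2,3` coded `0,1,2`), triangularly loud in this order (`28³ · 7` column tests in the kernel; found by the look-ahead search
`run/shared/lean/pub/pub-omega/pub-omega-stpp-1-g4/code/triusp7.py`).  For comparison, the largest STRONG USP of width 7 known has 23 rows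
(Anderson–Le 2023 App. A; the tree's `isStrongUSP_AndersonLe_23_7`).  Census bookkeeping (a kernel lower bound `s_max^USP(7) ≥ 28`; not in
print); plain USPs carry no `ω` bound. [cite: CohnKleinbergSzegedyUmans2005, §3 (p. 5), definition of a USP] -/
theorem isUSP_28_7 :
    IsUSP ![![2, 0, 0, 0, 0, 0, 0], ![0, 0, 0, 2, 0, 0, 1], ![0, 2, 0, 0, 1, 0, 0], ![1, 2, 0, 0, 2, 0, 0], ![2, 1, 0, 0, 0, 0, 2], ![1, 0, 2, 0, 0, 0, 1], ![2, 2, 0, 0, 0, 1, 0],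
      ![0, 0, 1, 0, 2, 0, 2], ![2, 0, 1, 2, 1, 0, 0], ![0, 1, 0, 2, 2, 0, 1], ![2, 2, 0, 1, 0, 0, 2], ![1, 1, 2, 1, 0, 0, 2], ![0, 1, 0, 1, 0, 2, 1], ![0, 2, 1, 2, 2, 0, 1],
      ![2, 0, 1, 1, 2, 0, 2], ![1, 2, 2, 0, 1, 0, 0], ![0, 1, 1, 2, 0, 2, 0], ![1, 2, 2, 1, 1, 0, 2], ![2, 1, 0, 0, 1, 2, 2], ![1, 1, 1, 0, 2, 2, 0], ![1, 0, 2, 2, 2, 1, 0],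
      ![0, 1, 2, 1, 1, 2, 0], ![2, 1, 2, 0, 1, 2, 1], ![2, 2, 2, 2, 1, 1, 0], ![2, 0, 1, 1, 2, 2, 1], ![1, 2, 0, 2, 1, 1, 2], ![0, 2, 1, 2, 2, 1, 2], ![1, 1, 2, 1, 1, 2, 2]] :=
  isUSP_of_triLoud (by decide +kernel)

/-- Hence USPs of width 7 with `s` rows exist for every `s ≤ 28`. [cite: AndersonJiXu2020, Lemma 5 (arXiv:2301.00074v1 §3.5)] -/
theorem exists_isUSP_width_seven {s : ℕ} (hs : s ≤ 28) : ∃ row : Fin s → Fin 7 → Fin 3, IsUSP row :=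
  ⟨_, isUSP_28_7.restrict (Fin.castLE hs) (Fin.castLE_injective hs)⟩

end Summit.MatrixMultiplication.OmegaCensus
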